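import Summits.BirchSwinnertonDyer.BirchSwinnertonDyer.Theorems.GenusKolyvaginAtTwoPowDvdShaCardAtTwoRTRankDescentChebotarev
import Summits.BirchSwinnertonDyer.BirchSwinnertonDyer.Theorems.GenusKolyvaginAtTwoPowDvdShaCardAtTwoRTTwoTermIdentityKolyvagin
import Summits.BirchSwinnertonDyer.BirchSwinnertonDyer.Theorems.Rank1ResidualJetCompatibleData
import Summits.BirchSwinnertonDyer.BirchSwinnertonDyer.Theorems.GenusKolyvaginAtTwoPowDvdShaCardAtTwoRTGenusKernel
import Summits.BirchSwinnertonDyer.BirchSwinnertonDyer.Theorems.GenusKolyvaginAtTwoPowDvdShaCardAtTwoRTMixedPairChebotarev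
import Summits.BirchSwinnertonDyer.BirchSwinnertonDyer.Theses.GenusKolyvaginAtTwo
import HarnessLib

/-!
# Route `GenusKolyvaginAtTwo`, LINE 18 (L_T `PowDvdShaCardAtTwoRT`, stmt-BirchSwinnertonDyer-23659), road (E4), P-reduction —
# KOLYVAGIN'S TWO EXPONENT LAWS AT `2` ON THE SELMER SIDE (Gross 1991 Claims 10.1 / 10.3 at level `2^M`, one bit lost)

Seat `bsd-line-gk2-p4` g21 (WIDTH-5 attach, cell `bsd-f1-sign2`), `--supports stmt-BirchSwinnertonDyer-23659` (helper; closes nothing).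
THEOREMS ONLY (no definition, no named fact, no `sorry`).  BSD is NOT proved by any of this; neither is the crux.

WHY.  Road (E4) closes L_T by name modulo the print bundle `PubInputsAtTwo`, used ONLY as «rank E(K) ≤ 1» (`…RTOrthogonalCapstoneRankLeOne`).
Rank `≤ 1` is Kolyvagin's descent; on L_T's habitat it runs AT `2` with the in-statement relation Q2 (`KolyvaginRelationAtTwo`), Q5R
(McCallum Cor. 3.2 at `2`, tree theorem), (NPh) and the LINE's local eigen-duality law.  The two laws the algebra `…RTRankDescentAlgebra`
consumes, for the complex conjugation `τ` and `c_M(1) = δ_M y_K` (sign `−w(E)`, Gross 5.4):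
* (B) `addOrderOf_mul_addOrderOf_dvd_of_sign_rootNumber` — `s ∈ Sel_{2^M}(E/K)` with `τ_* s = w(E)•s` has `ord s · ord c_M(1) ∣ 2^{M+1}`:
  one Kolyvagin prime `ℓ` with `s`, `c_M(1)` of full local order (`…RTRankDescentChebotarev`), the class `c_M(ℓ)` (sign `w(E)`, Kummer off `ℓ`,
  Kummer-threshold at `λ` = zero-threshold of `c_M(1)` by Q2); the Poitou–Tate sum for `(s, c_M(ℓ))` has ONE surviving term, which therefore
  vanishes, and `addOrderOf_invWeilPairing_localization_eq_of_same_sign` reads `ord(loc s)·ord(loc c_M(1)) ∣ 2^{M+1}`;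
* (A) `addOrderOf_mul_addOrderOf_dvd_of_sign_neg_rootNumber_of_disjoint` — `s` with `τ_* s = −w(E)•s` and `⟨s⟩ ∩ ⟨q⟩ = 0` for a Selmer carrier
  `q` (`τ_* q = −w(E)•q`, `c_M(1) ∈ ⟨q⟩`) has the same bound: `ℓ′` with `q` of full local order and `s` LOCALLY ZERO (Q5R on the independent
  pair), `c′ = c_M(ℓ′)` with `ord c′ ≥ ord c_M(1)` (Q2 at `λ′`), `ℓ` with `s`, `c′` of full local order; for `(s, c_M(ℓ′ℓ))` (sign `−w(E)`) the
  `λ′`-term vanishes as `loc_{λ′} s = 0`, the `λ`-term is the only survivor, and the law at `λ` gives `ord s · ord(loc_λ c′) ∣ 2^{M+1}`.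

References: [GrossLMS1991] §10 (Claims 10.1, 10.3), Props. 5.4, 6.2, 8.2; [McCallumLMS1991] §3 Cor. 3.2, §4 Prop. 4.4, §5 Lemma 5.3;
[Kolyvagin1991MathAnn] Thm. 2.1; [MilneADT2006] Ch. I, Thm. 4.10(b).
-/

set_option autoImplicit false

noncomputable section

open scoped Classical
open Function Field NumberField IsDedekindDomain WeierstrassCurve
open Literature.NumberTheory.EllipticCurves Literature.NumberTheory.EllipticCurves.ModularForms
open Literature.NumberTheory.EllipticCurves.RingClassField
open Literature.NumberTheory.GaloisRepresentations Literature.NumberTheory.GaloisCohomology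
open Summit.BirchSwinnertonDyer.Rank1Residual
open Summit.BirchSwinnertonDyer.Rank1Residual.X11b.Relaxation
open Summit.BirchSwinnertonDyer.Rank1Residual.X11b.KummerPT
open Summit.BirchSwinnertonDyer.Rank1Residual.JET.GlobalDuality
open Summit.BirchSwinnertonDyer.BirchSwinnertonDyer.Theses.GenusKolyvaginAtTwo (KolyvaginRelationAtTwo)

-- the Theorems namespace of this sub repeats the summit name by design (D-0017 nested layout)
set_option linter.dupNamespace false

namespace Summit.BirchSwinnertonDyer.BirchSwinnertonDyer.Theorems.GenusExact.PlusDescent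

variable (W : WeierstrassCurve ℚ) [W.IsElliptic] [W.IsGloballyMinimal] [NeZero (W.conductorNorm ℤ)]
  (K : Type) [Field K] [NumberField K]

/-! ## §1 Small bookkeeping -/

omit [W.IsElliptic] [W.IsGloballyMinimal] [NeZero (W.conductorNorm ℤ)] in
/-- The order of a class of `H¹(K, E[2^M])` is `2^N` for some `N ≤ M`. [folklore] -/
theorem exists_addOrderOf_galH1Torsion_eq_two_pow (M : ℕ) (x : galH1Torsion (W.baseChange K) ((2 ^ M : ℕ) : ℤ)) :
    ∃ N : ℕ, N ≤ M ∧ addOrderOf x = 2 ^ N := by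
  have hx : ((2 ^ M : ℕ) : ℤ) • x = 0 := zsmul_discreteH1_torsion ((2 ^ M : ℕ) : ℤ) x
  have hdvd : addOrderOf x ∣ 2 ^ M := by
    rw [addOrderOf_dvd_iff_nsmul_eq_zero, ← natCast_zsmul]
    exact hx
  obtain ⟨N, hN, hxN⟩ := (Nat.dvd_prime_pow Nat.prime_two).mp hdvd
  exact ⟨N, hN, hxN⟩

omit [W.IsElliptic] [W.IsGloballyMinimal] [NeZero (W.conductorNorm ℤ)] in
/-- Thresholds from an order: if `ord x = 2^N` then `2^j • x = 0 ⟺ N ≤ j`. [folklore] -/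
theorem two_pow_zsmul_eq_zero_iff_of_addOrderOf {M : ℕ} {x : galH1Torsion (W.baseChange K) ((2 ^ M : ℕ) : ℤ)} {N : ℕ}
    (hx : addOrderOf x = 2 ^ N) (j : ℕ) : ((2 ^ j : ℕ) : ℤ) • x = 0 ↔ N ≤ j := by
  rw [natCast_zsmul, ← addOrderOf_dvd_iff_nsmul_eq_zero, hx, Nat.pow_dvd_pow_iff_le_right (by norm_num)]


omit [W.IsElliptic] [W.IsGloballyMinimal] [NeZero (W.conductorNorm ℤ)] in
/-- **Full local order is inherited by multiples.**  If `q` (of order `2^{m}`, `m ≥ 1`) has full local order at a subgroup `H` — «`2^j • q ∈ H ⟺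
m ≤ j`» — then `⟨q⟩ ∩ H = 0`, so every `y ∈ ⟨q⟩` of order `2^κ` has «`2^j • y ∈ H ⟺ κ ≤ j`» (a non-zero element of `⟨q⟩ ∩ H` would put the
socle `2^{m−1} q` in `H`). [folklore] -/
theorem two_pow_zsmul_mem_iff_of_mem_zmultiples_of_full {M : ℕ} (H : AddSubgroup (galH1Torsion (W.baseChange K) ((2 ^ M : ℕ) : ℤ)))
    {q y : galH1Torsion (W.baseChange K) ((2 ^ M : ℕ) : ℤ)} {m κ : ℕ} (hm : 1 ≤ m) (hq : addOrderOf q = 2 ^ m)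
    (hfull : ∀ j : ℕ, ((2 ^ j : ℕ) : ℤ) • q ∈ H ↔ m ≤ j) (hyq : y ∈ AddSubgroup.zmultiples q) (hy : addOrderOf y = 2 ^ κ) (j : ℕ) :
    ((2 ^ j : ℕ) : ℤ) • y ∈ H ↔ κ ≤ j := by
  -- `⟨q⟩ ∩ H = 0`
  have hinf : ∀ x ∈ AddSubgroup.zmultiples q, x ∈ H → x = 0 := by
    intro x hxq hxH
    by_contra hx0
    obtain ⟨e, -, he⟩ := exists_addOrderOf_galH1Torsion_eq_two_pow W K M x
    have he1 : 1 ≤ e := by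
      by_contra h
      have : e = 0 := by omega
      rw [this, pow_zero, AddMonoid.addOrderOf_eq_one_iff] at he
      exact hx0 he
    obtain ⟨hγ0, hγ2, hγmem⟩ := pow_pred_nsmul_socle he1 he Nat.prime_two
    have hγH : 2 ^ (e - 1) • x ∈ H := H.nsmul_mem hxH _
    have hγq : 2 ^ (e - 1) • x ∈ AddSubgroup.zmultiples q := AddSubgroup.nsmul_mem _ hxq _
    have hsoc := eq_pow_pred_nsmul_of_mem_zmultiples hγ2 hγ0 hm hq hγq
    rw [hsoc] at hγH
    have h := (hfull (m - 1)).mp (by rw [natCast_zsmul]; exact hγH)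
    omega
  rw [← two_pow_zsmul_eq_zero_iff_of_addOrderOf W K hy j]
  constructor
  · exact fun h ↦ hinf _ (AddSubgroup.zsmul_mem _ hyq _) h
  · intro h
    rw [h]
    exact H.zero_mem

/-! ## §2 Law (B): the eigenclass of sign `w(E)` (Gross Claim 10.1 at level `2^M`) -/

/-- **Law (B).**  On the route's frame (non-CM, `Δ < 0`, odd Tamagawa, `ρ_{E,2^∞}` onto; `K` imaginary quadratic, `d_K` odd `≠ −3`, Heegner,
`d_K·(−|Δ|)` non-square; `τ ≠ 1`; `M ≥ 1` with (NPh_M); Q2 by name; `d₁` a Kolyvagin–Heegner datum of conductor `1`): every Selmer class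
`s ∈ Sel_{2^M}(E/K)` with `τ_* s = w(E) • s` satisfies `ord s · ord c_M(1) ∣ 2^{M+1}`.
[cite: GrossLMS1991, §10 Claim 10.1, Prop. 6.2, Prop. 8.2] [cite: McCallumLMS1991, §3 Cor. 3.2, §5 Lemma 5.3] [cite: Kolyvagin1991MathAnn, Thm. 2.1] -/
theorem addOrderOf_mul_addOrderOf_dvd_of_sign_rootNumber (hQ2 : KolyvaginRelationAtTwo) (hcm : ¬ W.HasCM)
    (hρ : ∀ n : ℕ, W.HasSurjectiveModNGaloisRep (2 ^ n : ℕ)) (hc : Odd W.tamagawaProduct) (hΔ : W.Δ < 0)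
    (hK : IsImaginaryQuadratic K) (hodd : Odd (NumberField.discr K)) (hD3 : NumberField.discr K ≠ -3)
    (hH : SatisfiesHeegnerHypothesis (W.conductorNorm ℤ) K) (hns : ¬ IsSquare ((NumberField.discr K : ℚ) * -|W.Δ|))
    (Dt : ModularParametrizationData W (W.conductorNorm ℤ)) (β : ℤ) (ι : K →+* ℂ)
    [∀ j : ℕ, NumberField (ringClassField K ι j)] {M : ℕ} (hM : 1 ≤ M) {τ : K ≃ₐ[ℚ] K} (hτ1 : τ ≠ 1)
    (hNPh : ∀ z : galH1Torsion (W.baseChange K) ((2 ^ M : ℕ) : ℤ),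
      (∀ ρ ∈ torsionFixing (W.baseChange K) ((2 ^ M : ℕ) : ℤ), h1Eval (W.baseChange K) ((2 ^ M : ℕ) : ℤ) z ρ = 0) →
      (∀ w : HeightOneSpectrum (𝓞 K), z ∈ selmerLocalKer (W.baseChange K) (w.adicCompletion K) ((2 ^ M : ℕ) : ℤ)) → z = 0)
    (d₁ : KolyvaginHeegnerData Dt β ι 1)
    (s : galH1Torsion (W.baseChange K) ((2 ^ M : ℕ) : ℤ)) (hsSel : s ∈ selmerGroup (W.baseChange K) ((2 ^ M : ℕ) : ℤ))
    (hτs : conjAct W τ ((2 ^ M : ℕ) : ℤ) s = W.rootNumber • s) :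
    addOrderOf s * addOrderOf (d₁.kolyvaginClass Nat.prime_two M) ∣ 2 ^ (M + 1) := by
  haveI : Fact (Nat.Prime 2) := ⟨Nat.prime_two⟩
  have hD4 : NumberField.discr K ≠ -4 := fun h ↦ by
    rw [h] at hodd; exact (Int.not_even_iff_odd.mpr hodd) ⟨-2, by norm_num⟩
  have hD : NumberField.discr K < -4 := X11b.KolyvaginAssembly.discr_lt_neg_four hK ⟨hD3, hD4⟩
  have hsurj : ∀ k : ℕ, W.HasSurjectiveModNGaloisRep ((2 ^ k : ℕ) : ℤ) := fun k ↦ by exact_mod_cast hρ k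
  have hsurj1 : W.HasSurjectiveModNGaloisRep ((2 : ℤ) ^ 1) := by exact_mod_cast hsurj 1
  have hττ : τ * τ = 1 := mul_self_eq_one_of_ne_one K hK.1 τ hτ1
  have hw : W.rootNumber = 1 ∨ W.rootNumber = -1 := W.rootNumber_eq_one_or
  set y := d₁.kolyvaginClass Nat.prime_two M with hy_def
  -- ### orders `2^a`, `2^κ`; the degenerate cases
  obtain ⟨a, haM, ha⟩ := exists_addOrderOf_galH1Torsion_eq_two_pow W K M s
  obtain ⟨κ, hκM, hκ⟩ := exists_addOrderOf_galH1Torsion_eq_two_pow W K M y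
  rw [ha, hκ, ← pow_add, Nat.pow_dvd_pow_iff_le_right (by norm_num)]
  by_cases ha0 : a = 0
  · omega
  by_cases hκ0 : κ = 0
  · omega
  have ha1 : 1 ≤ a := Nat.one_le_iff_ne_zero.mpr ha0
  have hκ1 : 1 ≤ κ := Nat.one_le_iff_ne_zero.mpr hκ0
  -- ### the Kolyvagin prime `ℓ`: `s` and `c_M(1)` of full local order
  have h1K : ∀ q ∈ (1 : ℕ).primeFactors, Zhang2014.IsKolyvaginPrime (W.conductorNorm ℤ) W K 2 q ∧
      M ≤ Zhang2014.kolyvaginIndex W 2 q := by simp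
  obtain ⟨ℓ, -, -, hℓ, hidx, hF, hloc⟩ := exists_kolyvaginPrime_fullOrder_selmer_kolyvagin W hcm hΔ hc hρ hK hodd hD3 hH hns τ
    hτ1 hM hNPh s hsSel hw hτs ha1 ha squarefree_one h1K d₁ hκ1 hκ ∅
  have hℓp : ℓ.Prime := hℓ.1
  -- ### the datum at conductor `ℓ`, compatible with `d₁`
  obtain ⟨dℓ, hdℓ⟩ := JET.exists_compatible_data_of_grossCM
    (phi_heegnerPointOfConductor_mem_range_map_ringClassField_holds (W.conductorNorm ℤ) W K) hK hD hH 2 Dt β ι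
    squarefree_one (by simp) d₁
  have hℓ1 : ℓ ∉ (1 : ℕ).primeFactors := by simp
  obtain ⟨hσ', hS', hS'', hemb'⟩ := hdℓ ℓ hℓ hℓ1
  set d' := dℓ ℓ hℓ hℓ1 with hd'_def
  set x := d'.kolyvaginClass Nat.prime_two M with hx_def
  -- ### the place `λ`
  obtain ⟨w, hwℓ⟩ := VisiblePairAtTwo.exists_natCast_mem (K := K) hℓp
  have hfix : τ • w = w := smul_place_eq_of_zhangKolyvaginPrime W K hℓ τ hwℓ
  obtain ⟨hαs, hαy⟩ := hloc w hwℓ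
  -- ### numerics of the conductor `1 * ℓ`
  have hc' : Squarefree (1 * ℓ) := by rw [one_mul]; exact hℓp.squarefree
  have hℓn : ¬ ℓ ∣ 1 := fun h ↦ hℓp.one_lt.ne' (Nat.dvd_one.mp h)
  have hk'all : ∀ q ∈ (1 * ℓ).primeFactors,
      Zhang2014.IsKolyvaginPrime (W.conductorNorm ℤ) W K 2 q ∧ M ≤ Zhang2014.kolyvaginIndex W 2 q := by
    intro q hq
    rw [one_mul, hℓp.primeFactors, Finset.mem_singleton] at hq
    subst hq
    exact ⟨hℓ, hidx⟩
  have hcard : (1 * ℓ).primeFactors.card = 1 := by rw [one_mul, hℓp.primeFactors, Finset.card_singleton]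
  -- ### the sign of `c_M(ℓ)` is `w(E)` (Gross 5.4 at `2`)
  obtain ⟨-, hx⟩ := KolyvaginClassSign.sign_conjAct_kolyvaginClass_two hK hD3 hD4 hodd hH hsurj1 τ hτ1 Dt β ι hc' hM hk'all d'
  rw [hcard, pow_one, mul_neg_one, neg_neg] at hx
  -- ### Q2 at the own prime `ℓ`: the Kummer-threshold of `c_M(ℓ)` at `λ` is the zero-threshold `κ` of `c_M(1)`
  have hQ := hQ2 W hcm K hK hD3 hD4 hH hρ Dt β ι M hM 1 ℓ hc' hℓp hℓn hk'all d₁ d' hσ' hS' hS'' hemb' w hwℓ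
  have hβ : ∀ j : ℕ, ((2 ^ j : ℕ) : ℤ) • x ∈ selmerLocalKer (W.baseChange K) (w.adicCompletion K) ((2 ^ M : ℕ) : ℤ) ↔ κ ≤ j :=
    fun j ↦ (hQ j).1.trans (((hQ j).2).trans (hαy j))
  -- ### the Weil datum and THE canonical invariant family
  obtain ⟨e, hμ, hadd₁, hadd₂, halt, hnondeg, hgal, hlift⟩ :=
    exists_weilPairing_liftEquivariant W K (2 ^ M) (le_trans (by norm_num) (Nat.pow_le_pow_right (by norm_num) hM))
  have hinj : ∀ v : HeightOneSpectrum (𝓞 K), Injective (LocalInvariants.canonical K (2 ^ M) (Sum.inr v)) :=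
    fun v ↦ ((LocalInvariants.canonical_isPerfect (K := K) (n := 2 ^ M)) v).1.1
  have hinvc : (LocalInvariants.canonical K (2 ^ M)).IsConjCompatible τ := isConjCompatible_canonical τ (2 ^ M)
  have hte : ∀ S T, e ((isLiftOfAut_liftAutPlace τ hfix).torsionMap W ((2 ^ M : ℕ) : ℤ) S)
      ((isLiftOfAut_liftAutPlace τ hfix).torsionMap W ((2 ^ M : ℕ) : ℤ) T) = liftAutPlace τ hfix (e S T) :=
    fun S T ↦ (hlift τ _ (isLiftOfAut_liftAutPlace τ hfix) S T).symm
  -- ### the Poitou–Tate sum for `(s, c_M(ℓ))` has one surviving term, at `λ`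
  have hsT : s ∈ kummerOutside (W.baseChange K) (2 ^ M) {(Sum.inr w : Place K)} :=
    selmerGroup_le_kummerOutside (W.baseChange K) (2 ^ M) _ hsSel
  have hxT : x ∈ kummerOutside (W.baseChange K) (2 ^ M) {(Sum.inr w : Place K)} := by
    refine kolyvaginClass_two_mem_kummerOutside W K hsurj hc hK hD3 hD4 hH Dt β ι M hc' hk'all d' _ fun v hv ↦ ?_
    rw [one_mul] at hv
    rw [eq_of_natCast_mem_of_zhangKolyvaginPrime hℓ hwℓ hv]
    exact Finset.mem_singleton_self _
  have hsum := sum_invWeilPairing_localization_eq_zero_of_mem_kummerOutside (W.baseChange K) (2 ^ M) e hμ hadd₁ hadd₂ hgal halt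
    (LocalInvariants.canonical K (2 ^ M))
    (Summit.BirchSwinnertonDyer.BirchSwinnertonDyer.Theorems.SchneiderFreeAdditiveX3.PoitouTateReduction.sumLocalTermEqZero_canonical
      (K := K) (2 ^ M)) {(Sum.inr w : Place K)} hsT hxT
  rw [Finset.sum_singleton] at hsum
  -- ### the local law at `λ`: the surviving term has order `2^(a + κ − (M+1))`
  have hsS : galoisCohomology.localization ((W.baseChange K).torsionGaloisModule ((2 ^ M : ℕ) : ℤ)) (Sum.inr w : Place K) 1 s ∈
      (W.baseChange K).kummerSelmerStructure ((2 ^ M : ℕ) : ℤ) (Sum.inr w) :=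
    (mem_kummerOutside_iff (W.baseChange K) (2 ^ M) ∅ s).mp (selmerGroup_le_kummerOutside (W.baseChange K) (2 ^ M) ∅ hsSel)
      _ (Finset.notMem_empty _)
  have hlaw := addOrderOf_invWeilPairing_localization_eq_of_same_sign W K hK hΔ hM hℓ hidx hF w hwℓ hτ1 hττ hfix e hμ hadd₁
    hadd₂ hgal halt hnondeg hte (LocalInvariants.canonical K (2 ^ M)) (hinj w) hinvc hw hτs hx hsS
    (fun j ↦ (pow_zsmul_mem_torsionLocalKer_iff W K M w s j).symm.trans (hαs j))
    (fun j ↦ (pow_zsmul_mem_selmerLocalKer_iff W K M w x j).symm.trans (hβ j))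
  rw [hsum, addOrderOf_zero] at hlaw
  have h0 : a + κ - (M + 1) = 0 :=
    Nat.pow_right_injective le_rfl (hlaw.symm.trans (pow_zero 2).symm)
  omega


/-! ## §3 Law (A): the eigenclass of sign `−w(E)` disjoint from a carrier (Gross Claim 10.3 at level `2^M`) -/

/-- **Law (A).**  Same frame as law (B).  `q ∈ Sel_{2^M}(E/K)` a carrier of `c_M(1)` (`τ_* q = −w(E)•q`, `c_M(1) ∈ ⟨q⟩`); every Selmer class
`s ∈ Sel_{2^M}(E/K)` with `τ_* s = −w(E) • s` and `⟨s⟩ ∩ ⟨q⟩ = 0` satisfies `ord s · ord c_M(1) ∣ 2^{M+1}`.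
[cite: GrossLMS1991, §10 Claim 10.3, Prop. 6.2, Prop. 8.2] [cite: McCallumLMS1991, §3 Cor. 3.2, §4 Prop. 4.4, §5 Lemma 5.3]
[cite: Kolyvagin1991MathAnn, Thm. 2.1] -/
theorem addOrderOf_mul_addOrderOf_dvd_of_sign_neg_rootNumber_of_disjoint (hQ2 : KolyvaginRelationAtTwo) (hcm : ¬ W.HasCM)
    (hρ : ∀ n : ℕ, W.HasSurjectiveModNGaloisRep (2 ^ n : ℕ)) (hc : Odd W.tamagawaProduct) (hΔ : W.Δ < 0)
    (hK : IsImaginaryQuadratic K) (hodd : Odd (NumberField.discr K)) (hD3 : NumberField.discr K ≠ -3)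
    (hH : SatisfiesHeegnerHypothesis (W.conductorNorm ℤ) K) (hns : ¬ IsSquare ((NumberField.discr K : ℚ) * -|W.Δ|))
    (Dt : ModularParametrizationData W (W.conductorNorm ℤ)) (β : ℤ) (ι : K →+* ℂ)
    [∀ j : ℕ, NumberField (ringClassField K ι j)] {M : ℕ} (hM : 1 ≤ M) {τ : K ≃ₐ[ℚ] K} (hτ1 : τ ≠ 1)
    (hNPh : ∀ z : galH1Torsion (W.baseChange K) ((2 ^ M : ℕ) : ℤ),
      (∀ ρ ∈ torsionFixing (W.baseChange K) ((2 ^ M : ℕ) : ℤ), h1Eval (W.baseChange K) ((2 ^ M : ℕ) : ℤ) z ρ = 0) →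
      (∀ w : HeightOneSpectrum (𝓞 K), z ∈ selmerLocalKer (W.baseChange K) (w.adicCompletion K) ((2 ^ M : ℕ) : ℤ)) → z = 0)
    (d₁ : KolyvaginHeegnerData Dt β ι 1)
    (q : galH1Torsion (W.baseChange K) ((2 ^ M : ℕ) : ℤ)) (hqSel : q ∈ selmerGroup (W.baseChange K) ((2 ^ M : ℕ) : ℤ))
    (hτq : conjAct W τ ((2 ^ M : ℕ) : ℤ) q = (-W.rootNumber) • q)
    (hyq : d₁.kolyvaginClass Nat.prime_two M ∈ AddSubgroup.zmultiples q)
    (s : galH1Torsion (W.baseChange K) ((2 ^ M : ℕ) : ℤ)) (hsSel : s ∈ selmerGroup (W.baseChange K) ((2 ^ M : ℕ) : ℤ))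
    (hτs : conjAct W τ ((2 ^ M : ℕ) : ℤ) s = (-W.rootNumber) • s)
    (hdisj : Disjoint (AddSubgroup.zmultiples s) (AddSubgroup.zmultiples q)) :
    addOrderOf s * addOrderOf (d₁.kolyvaginClass Nat.prime_two M) ∣ 2 ^ (M + 1) := by
  haveI : Fact (Nat.Prime 2) := ⟨Nat.prime_two⟩
  have hD4 : NumberField.discr K ≠ -4 := fun h ↦ by
    rw [h] at hodd; exact (Int.not_even_iff_odd.mpr hodd) ⟨-2, by norm_num⟩
  have hD : NumberField.discr K < -4 := X11b.KolyvaginAssembly.discr_lt_neg_four hK ⟨hD3, hD4⟩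
  have hsurj : ∀ k : ℕ, W.HasSurjectiveModNGaloisRep ((2 ^ k : ℕ) : ℤ) := fun k ↦ by exact_mod_cast hρ k
  have hsurj1 : W.HasSurjectiveModNGaloisRep ((2 : ℤ) ^ 1) := by exact_mod_cast hsurj 1
  have hττ : τ * τ = 1 := mul_self_eq_one_of_ne_one K hK.1 τ hτ1
  have hw : -W.rootNumber = 1 ∨ -W.rootNumber = -1 := by
    rcases W.rootNumber_eq_one_or with h | h <;> simp [h]
  have hCM := phi_heegnerPointOfConductor_mem_range_map_ringClassField_holds (W.conductorNorm ℤ) W K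
  set y := d₁.kolyvaginClass Nat.prime_two M with hy_def
  -- ### orders `2^a`, `2^κ`, `2^m`; the degenerate cases
  obtain ⟨a, haM, ha⟩ := exists_addOrderOf_galH1Torsion_eq_two_pow W K M s
  obtain ⟨κ, hκM, hκ⟩ := exists_addOrderOf_galH1Torsion_eq_two_pow W K M y
  obtain ⟨m, hmM, hm⟩ := exists_addOrderOf_galH1Torsion_eq_two_pow W K M q
  rw [ha, hκ, ← pow_add, Nat.pow_dvd_pow_iff_le_right (by norm_num)]
  by_cases ha0 : a = 0
  · omega
  by_cases hκ0 : κ = 0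
  · omega
  have ha1 : 1 ≤ a := Nat.one_le_iff_ne_zero.mpr ha0
  have hκ1 : 1 ≤ κ := Nat.one_le_iff_ne_zero.mpr hκ0
  have hm1 : 1 ≤ m := by
    by_contra h
    have hm0 : m = 0 := by omega
    rw [hm0, pow_zero, AddMonoid.addOrderOf_eq_one_iff] at hm
    rw [hm, AddSubgroup.zmultiples_zero_eq_bot, AddSubgroup.mem_bot] at hyq
    rw [hyq, addOrderOf_zero] at hκ
    have : κ = 0 := (Nat.pow_right_injective le_rfl (hκ.symm.trans (pow_zero 2).symm))
    exact hκ0 this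
  -- ### STEP 1. the prime `ℓ′`: `q` of full local order, `s` locally ZERO (Q5R on the independent pair)
  obtain ⟨ℓ', -, hℓ', hidx', hF', hloc'⟩ := exists_kolyvaginPrime_prescribed_selmer_pair W hcm hΔ hρ hK hns τ hτ1 hM hNPh q s
    hqSel hsSel hw hw hτq hτs hm1 ha1 hm ha hdisj le_rfl (Nat.zero_le a) ∅
  have hℓ'p : ℓ'.Prime := hℓ'.1
  obtain ⟨w', hw'ℓ⟩ := VisiblePairAtTwo.exists_natCast_mem (K := K) hℓ'p
  obtain ⟨hq', hs'⟩ := hloc' w' hw'ℓ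
  -- `c_M(1) = y ∈ ⟨q⟩` has full local order `2^κ` at `λ′`
  have hy' : ∀ j : ℕ, ((2 ^ j : ℕ) : ℤ) • y ∈ (W.baseChange K).torsionLocalKer (w'.adicCompletion K) ((2 ^ M : ℕ) : ℤ) ↔ κ ≤ j :=
    two_pow_zsmul_mem_iff_of_mem_zmultiples_of_full W K _ hm1 hm hq' hyq hκ
  -- ### the datum at conductor `ℓ′` and the class `c′ = c_M(ℓ′)`
  obtain ⟨dℓ, hdℓ⟩ := JET.exists_compatible_data_of_grossCM hCM hK hD hH 2 Dt β ι squarefree_one (by simp) d₁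
  have hℓ'1 : ℓ' ∉ (1 : ℕ).primeFactors := by simp
  obtain ⟨hσ', hS', hS'', hemb'⟩ := hdℓ ℓ' hℓ' hℓ'1
  set d' := dℓ ℓ' hℓ' hℓ'1 with hd'_def
  set c' := d'.kolyvaginClass Nat.prime_two M with hc'_def
  have hn' : Squarefree (1 * ℓ') := by rw [one_mul]; exact hℓ'p.squarefree
  have hℓ'n : ¬ ℓ' ∣ 1 := fun h ↦ hℓ'p.one_lt.ne' (Nat.dvd_one.mp h)
  have hk'all : ∀ p ∈ (1 * ℓ').primeFactors,
      Zhang2014.IsKolyvaginPrime (W.conductorNorm ℤ) W K 2 p ∧ M ≤ Zhang2014.kolyvaginIndex W 2 p := by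
    intro p hp
    rw [one_mul, hℓ'p.primeFactors, Finset.mem_singleton] at hp
    subst hp
    exact ⟨hℓ', hidx'⟩
  -- Q2 at `λ′`: `c′` has Kummer-threshold `κ` at `λ′`; hence `ord c′ = 2^γ′` with `κ ≤ γ′`
  have hQ' := hQ2 W hcm K hK hD3 hD4 hH hρ Dt β ι M hM 1 ℓ' hn' hℓ'p hℓ'n hk'all d₁ d' hσ' hS' hS'' hemb' w' hw'ℓ
  obtain ⟨γ', hγ'M, hγ'⟩ := exists_addOrderOf_galH1Torsion_eq_two_pow W K M c'
  have hκγ : κ ≤ γ' := by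
    have h0 : ((2 ^ γ' : ℕ) : ℤ) • c' = 0 := (two_pow_zsmul_eq_zero_iff_of_addOrderOf W K hγ' γ').mpr le_rfl
    have h1 : ((2 ^ γ' : ℕ) : ℤ) • c' ∈ (W.baseChange K).torsionLocalKer (w'.adicCompletion K) ((2 ^ M : ℕ) : ℤ) := by
      rw [h0]; exact AddSubgroup.zero_mem _
    exact (hy' γ').mp (((hQ' γ').2).mp h1)
  have hγ'1 : 1 ≤ γ' := hκ1.trans hκγ
  -- ### STEP 2. the prime `ℓ`: `s` and `c′` of full local order
  obtain ⟨ℓ, -, hℓℓ', hℓ, hidx, hF, hloc⟩ := exists_kolyvaginPrime_fullOrder_selmer_kolyvagin W hcm hΔ hc hρ hK hodd hD3 hH hns τ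
    hτ1 hM hNPh s hsSel hw hτs ha1 ha hn' hk'all d' hγ'1 hγ' ∅
  have hℓp : ℓ.Prime := hℓ.1
  have hne : ℓ ≠ ℓ' := by
    intro h
    apply hℓℓ'
    rw [h, one_mul, hℓ'p.primeFactors]
    exact Finset.mem_singleton_self _
  obtain ⟨w, hwℓ⟩ := VisiblePairAtTwo.exists_natCast_mem (K := K) hℓp
  have hfix : τ • w = w := smul_place_eq_of_zhangKolyvaginPrime W K hℓ τ hwℓ
  obtain ⟨hαs, hαc'⟩ := hloc w hwℓ
  -- ### the datum at conductor `ℓ′ℓ` and the class `x = c_M(ℓ′ℓ)`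
  obtain ⟨dℓ2, hdℓ2⟩ := JET.exists_compatible_data_of_grossCM hCM hK hD hH 2 Dt β ι hn' (fun p hp ↦ (hk'all p hp).1) d'
  obtain ⟨hσ'', hS2, hS2', hemb''⟩ := hdℓ2 ℓ hℓ hℓℓ'
  set d'' := dℓ2 ℓ hℓ hℓℓ' with hd''_def
  set x := d''.kolyvaginClass Nat.prime_two M with hx_def
  -- numerics of the conductor `(1 * ℓ′) * ℓ`
  have hℓn : ¬ ℓ ∣ 1 * ℓ' := by
    rw [one_mul, Nat.prime_dvd_prime_iff_eq hℓp hℓ'p]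
    exact hne
  have hn'' : Squarefree (1 * ℓ' * ℓ) :=
    (Nat.squarefree_mul ((Nat.Prime.coprime_iff_not_dvd hℓp).mpr hℓn).symm).mpr ⟨hn', hℓp.squarefree⟩
  have hprimes : (1 * ℓ' * ℓ).primeFactors = {ℓ', ℓ} := by
    rw [one_mul, Nat.primeFactors_mul hℓ'p.ne_zero hℓp.ne_zero, hℓ'p.primeFactors, hℓp.primeFactors]
    rfl
  have hk''all : ∀ p ∈ (1 * ℓ' * ℓ).primeFactors,
      Zhang2014.IsKolyvaginPrime (W.conductorNorm ℤ) W K 2 p ∧ M ≤ Zhang2014.kolyvaginIndex W 2 p := by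
    intro p hp
    rw [hprimes, Finset.mem_insert, Finset.mem_singleton] at hp
    rcases hp with rfl | rfl
    · exact ⟨hℓ', hidx'⟩
    · exact ⟨hℓ, hidx⟩
  have hcard : (1 * ℓ' * ℓ).primeFactors.card = 2 := by
    rw [hprimes, Finset.card_pair hne.symm]
  -- the sign of `x` is `−w(E)` (Gross 5.4 at `2`)
  obtain ⟨-, hx⟩ := KolyvaginClassSign.sign_conjAct_kolyvaginClass_two hK hD3 hD4 hodd hH hsurj1 τ hτ1 Dt β ι hn'' hM hk''all d''
  rw [hcard] at hx
  have hsign : -W.rootNumber * (-1) ^ 2 = -W.rootNumber := by ring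
  rw [hsign] at hx
  -- Q2 at the own prime `ℓ` of `(1*ℓ′)*ℓ`: the Kummer-threshold of `x` at `λ` is the zero-threshold `γ′` of `c′` there
  have hQ := hQ2 W hcm K hK hD3 hD4 hH hρ Dt β ι M hM (1 * ℓ') ℓ hn'' hℓp hℓn hk''all d' d'' hσ'' hS2 hS2' hemb'' w hwℓ
  have hβ : ∀ j : ℕ, ((2 ^ j : ℕ) : ℤ) • x ∈ selmerLocalKer (W.baseChange K) (w.adicCompletion K) ((2 ^ M : ℕ) : ℤ) ↔ γ' ≤ j :=
    fun j ↦ (hQ j).1.trans (((hQ j).2).trans (hαc' j))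
  -- ### the places `λ ≠ λ′`
  have hℓ'w : (ℓ' : 𝓞 K) ∉ w.asIdeal := fun h ↦ hne (JET.Walk.prime_eq_of_natCast_mem w hℓp hℓ'p hwℓ h)
  have hww' : w ≠ w' := fun h ↦ hℓ'w (h ▸ hw'ℓ)
  have hne' : (Sum.inr w : Place K) ≠ Sum.inr w' := fun h ↦ hww' (Sum.inr_injective h)
  -- ### the Weil datum and THE canonical invariant family
  obtain ⟨e, hμ, hadd₁, hadd₂, halt, hnondeg, hgal, hlift⟩ :=
    exists_weilPairing_liftEquivariant W K (2 ^ M) (le_trans (by norm_num) (Nat.pow_le_pow_right (by norm_num) hM))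
  have hinj : ∀ v : HeightOneSpectrum (𝓞 K), Injective (LocalInvariants.canonical K (2 ^ M) (Sum.inr v)) :=
    fun v ↦ ((LocalInvariants.canonical_isPerfect (K := K) (n := 2 ^ M)) v).1.1
  have hinvc : (LocalInvariants.canonical K (2 ^ M)).IsConjCompatible τ := isConjCompatible_canonical τ (2 ^ M)
  have hte : ∀ S T, e ((isLiftOfAut_liftAutPlace τ hfix).torsionMap W ((2 ^ M : ℕ) : ℤ) S)
      ((isLiftOfAut_liftAutPlace τ hfix).torsionMap W ((2 ^ M : ℕ) : ℤ) T) = liftAutPlace τ hfix (e S T) :=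
    fun S T ↦ (hlift τ _ (isLiftOfAut_liftAutPlace τ hfix) S T).symm
  -- ### the Poitou–Tate sum for `(s, x)`: Kummer off `{λ, λ′}`
  have hsT : s ∈ kummerOutside (W.baseChange K) (2 ^ M) {(Sum.inr w : Place K), Sum.inr w'} :=
    selmerGroup_le_kummerOutside (W.baseChange K) (2 ^ M) _ hsSel
  have hxT : x ∈ kummerOutside (W.baseChange K) (2 ^ M) {(Sum.inr w : Place K), Sum.inr w'} := by
    refine kolyvaginClass_two_mem_kummerOutside W K hsurj hc hK hD3 hD4 hH Dt β ι M hn'' hk''all d'' _ fun v hv ↦ ?_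
    rw [one_mul, Nat.cast_mul] at hv
    rcases v.isPrime.mem_or_mem hv with h | h
    · rw [eq_of_natCast_mem_of_zhangKolyvaginPrime hℓ' hw'ℓ h]
      exact Finset.mem_insert_of_mem (Finset.mem_singleton_self _)
    · rw [eq_of_natCast_mem_of_zhangKolyvaginPrime hℓ hwℓ h]
      exact Finset.mem_insert_self _ _
  have hsum := sum_invWeilPairing_localization_eq_zero_of_mem_kummerOutside (W.baseChange K) (2 ^ M) e hμ hadd₁ hadd₂ hgal halt
    (LocalInvariants.canonical K (2 ^ M))
    (Summit.BirchSwinnertonDyer.BirchSwinnertonDyer.Theorems.SchneiderFreeAdditiveX3.PoitouTateReduction.sumLocalTermEqZero_canonical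
      (K := K) (2 ^ M)) {(Sum.inr w : Place K), Sum.inr w'} hsT hxT
  rw [Finset.sum_pair hne'] at hsum
  -- ### the `λ′`-term vanishes: `loc_{λ′} s = 0`
  have hs0 : galoisCohomology.localization ((W.baseChange K).torsionGaloisModule ((2 ^ M : ℕ) : ℤ)) (Sum.inr w' : Place K) 1 s = 0 := by
    have h := (pow_zsmul_mem_torsionLocalKer_iff W K M w' s 0).mp ((hs' 0).mpr le_rfl)
    rwa [pow_zero, one_smul] at h
  rw [hs0, map_zero, AddMonoidHom.zero_apply, add_zero] at hsum
  -- ### the local law at `λ`: the surviving term has order `2^(a + γ′ − (M+1))`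
  have hsS : galoisCohomology.localization ((W.baseChange K).torsionGaloisModule ((2 ^ M : ℕ) : ℤ)) (Sum.inr w : Place K) 1 s ∈
      (W.baseChange K).kummerSelmerStructure ((2 ^ M : ℕ) : ℤ) (Sum.inr w) :=
    (mem_kummerOutside_iff (W.baseChange K) (2 ^ M) ∅ s).mp (selmerGroup_le_kummerOutside (W.baseChange K) (2 ^ M) ∅ hsSel)
      _ (Finset.notMem_empty _)
  have hlaw := addOrderOf_invWeilPairing_localization_eq_of_same_sign W K hK hΔ hM hℓ hidx hF w hwℓ hτ1 hττ hfix e hμ hadd₁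
    hadd₂ hgal halt hnondeg hte (LocalInvariants.canonical K (2 ^ M)) (hinj w) hinvc hw hτs hx hsS
    (fun j ↦ (pow_zsmul_mem_torsionLocalKer_iff W K M w s j).symm.trans (hαs j))
    (fun j ↦ (pow_zsmul_mem_selmerLocalKer_iff W K M w x j).symm.trans (hβ j))
  rw [hsum, addOrderOf_zero] at hlaw
  have h0 : a + γ' - (M + 1) = 0 :=
    Nat.pow_right_injective le_rfl (hlaw.symm.trans (pow_zero 2).symm)
  omega

end Summit.BirchSwinnertonDyer.BirchSwinnertonDyer.Theorems.GenusExact.PlusDescent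

end
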